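import Literature.NumberTheory.EllipticCurves.KellerYin2024.CharacterModulePrufer
import HarnessLib

/-!
# Crux `PrintCf2.SplitBadTwoRankOneOfFacts` (stmt-BirchSwinnertonDyer-20368), R2 road: THE PRIMAL PRÜFER LEVELS
# `ℤ/p^k ↪ ℚ_p/ℤ_p` (and `↪ A_θ = (F/𝓞)(θ)`), onto the `p^k`-torsion, tower-compatible

Cell `bsd-print-cf2`, WIDTH seat `bsd-line-cf2-p1-w7` g6 (prover-bsd-line-cf2-p1-w7-g6-0); `--supports
stmt-BirchSwinnertonDyer-20368` (helper, Theses-free). HONEST FRAMING: elementary abelian-group bookkeeping; nothing here closes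
the crux or a registered stub; BSD is not proved by any of this; no summit statement is proved by this seat. No definition
(existence statements only), no named fact, no `sorry`. UNCONDITIONAL, any prime `p`.

WHAT. The level assemblies of the R2 road (-w8 g5 B3c `LayerShapiro.locSurj_layerSubgroup_of_levelSurj`, -w7 g6 road (a)
`KummerProNull.locSurj_level_of_trivial`) take the finite levels of the coefficient module as BINDERS (`ι₀ : N₀ ↪ A` onto `A[p^k]`,
`ι : N ↪ A`, `j : N₀ → N`, `N₀ ≃+ ℤ/p^k`, …). This file supplies them for `A = ℚ_p/ℤ_p` (`QpModZp p`, generators `t_k = [p^{-k}]`,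
Literature `IwasawaTheory.PruferPontryaginDual`) and, by transport along any `A ≃+ ℚ_p/ℤ_p`, for KY's character module
`A_θ = charModule ∅ θ` (`charModuleEquiv θ`):
* `exists_levelHoms : ∃ ι : ∀ k, ℤ/p^k →+ ℚ_p/ℤ_p`, `ι k m = m • t_k`, each `ι k` injective with image `(ℚ_p/ℤ_p)[p^k]`, and
  `ι M (p^{M-k} m) = ι k m` (`k ≤ M`); `exists_nsmul_eq` (`ℚ_p/ℤ_p` is `p^k`-divisible);
* `exists_levelHoms_of_addEquiv`, `exists_levelHoms_charModule` (the same five properties for `A ≃+ ℚ_p/ℤ_p`, `A_θ`);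
* `smul_eq_self_of_unitChar_eq_one` (`θ = 1`: `Γ_K` acts trivially on `A_θ`).
beyond-print theorem: no. presearch: Hungerford I §3 Ex. 7 (structure of `Z(p^∞)`); tree `QpModZp.tgen` API (cmg3-p1).

References: Hungerford, *Algebra* I §3 Ex. 7; Keller–Yin (2024) §1.1; Greenberg, LNM 1716 §4.
-/

noncomputable section

set_option linter.dupNamespace false
set_option autoImplicit false

open Literature.NumberTheory.IwasawaTheory Literature.NumberTheory.IwasawaTheory.QpModZp
open Field Literature.NumberTheory.GaloisRepresentations
open Literature.NumberTheory.EllipticCurves Literature.NumberTheory.EllipticCurves.KellerYin2024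

namespace Summit.BirchSwinnertonDyer.BirchSwinnertonDyer.Theorems.PrintCf2.PruferLevels

variable {p : ℕ} [hp : Fact p.Prime]

/-- `m • x = (m : ℤ_p) • x` on `ℚ_p/ℤ_p`. [cite: Hungerford1974, Ch. I §3 Exercise 7 (PDF p. 88)] -/
theorem zsmul_eq_intCast_smul (m : ℤ) (x : QpModZp p) : m • x = (m : ℤ_[p]) • x :=
  (Int.cast_smul_eq_zsmul ℤ_[p] m x).symm

/-- `(m : ℤ_p) • t_k = 0 ↔ p^k ∣ m`. [cite: Hungerford1974, Ch. I §3 Exercise 7 (a) (PDF p. 88)] -/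
theorem intCast_smul_tgen_eq_zero_iff (m : ℤ) (k : ℕ) : (m : ℤ_[p]) • tgen p k = 0 ↔ ((p ^ k : ℕ) : ℤ) ∣ m := by
  rw [smul_tgen_eq_zero_iff, ← PadicInt.norm_le_pow_iff_mem_span_pow, PadicInt.norm_int_le_pow_iff_dvd, Nat.cast_pow]

/-- `m • t_k = 0 ↔ p^k ∣ m`. [cite: Hungerford1974, Ch. I §3 Exercise 7 (a) (PDF p. 88)] -/
theorem zsmul_tgen_eq_zero_iff (m : ℤ) (k : ℕ) : m • tgen p k = 0 ↔ ((p ^ k : ℕ) : ℤ) ∣ m := by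
  rw [zsmul_eq_intCast_smul, intCast_smul_tgen_eq_zero_iff]

/-- **`(ℚ_p/ℤ_p)[p^k] = ℤ_p · t_k`**: a `p^k`-torsion element is a `ℤ_p`-multiple of `t_k`.
[cite: Hungerford1974, Ch. I §3 Exercise 7 (d) (PDF p. 88)] -/
theorem exists_eq_smul_tgen_of_nsmul_eq_zero {a : QpModZp p} {k : ℕ} (ha : p ^ k • a = 0) :
    ∃ c : ℤ_[p], a = c • tgen p k := by
  obtain ⟨n, u, rfl⟩ := exists_eq_smul_tgen a
  rcases le_or_gt n k with h | h
  · obtain ⟨d, rfl⟩ := Nat.exists_eq_add_of_le h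
    exact ⟨u * (p : ℤ_[p]) ^ d, by rw [mul_smul, pow_smul_tgen_add]⟩
  · obtain ⟨d, rfl⟩ := Nat.exists_eq_add_of_lt h
    have h1 : ((p : ℤ_[p]) ^ k * u) • tgen p (k + d + 1) = 0 := by
      rw [mul_smul, ← Nat.cast_pow, Nat.cast_smul_eq_nsmul]; exact ha
    rw [smul_tgen_eq_zero_iff] at h1
    obtain ⟨e, he⟩ := Ideal.mem_span_singleton'.mp h1
    have hp0 : (p : ℤ_[p]) ^ k ≠ 0 := pow_ne_zero _ (by exact_mod_cast hp.out.ne_zero)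
    have hu : u = e * (p : ℤ_[p]) ^ (d + 1) := by
      apply mul_left_cancel₀ hp0
      rw [← he]; ring
    refine ⟨e, ?_⟩
    rw [hu, mul_smul, show k + d + 1 = k + (d + 1) from by ring, pow_smul_tgen_add]

/-- … and a NATURAL-NUMBER multiple of `t_k`. [cite: Hungerford1974, Ch. I §3 Exercise 7 (d) (PDF p. 88)] -/
theorem exists_eq_natCast_smul_tgen_of_nsmul_eq_zero {a : QpModZp p} {k : ℕ} (ha : p ^ k • a = 0) :
    ∃ m : ℕ, a = (m : ℤ_[p]) • tgen p k := by
  obtain ⟨c, rfl⟩ := exists_eq_smul_tgen_of_nsmul_eq_zero ha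
  exact ⟨c.appr k, by rw [smul_tgen_eq_appr_smul, Nat.cast_smul_eq_nsmul]⟩

/-- **`ℚ_p/ℤ_p` is `p^k`-divisible.** [cite: Hungerford1974, Ch. I §3 Exercise 7 (PDF p. 88)] -/
theorem exists_nsmul_eq (k : ℕ) (a : QpModZp p) : ∃ b : QpModZp p, p ^ k • b = a := by
  obtain ⟨n, u, rfl⟩ := exists_eq_smul_tgen a
  refine ⟨u • tgen p (n + k), ?_⟩
  rw [smul_comm, ← Nat.cast_smul_eq_nsmul ℤ_[p] (p ^ k), Nat.cast_pow, pow_smul_tgen_add]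

/-- **THE PRIMAL PRÜFER LEVELS.** A family `ι k : ℤ/p^k →+ ℚ_p/ℤ_p` (`k ∈ ℕ`) with `ι k m = m • t_k`, each `ι k` INJECTIVE with image
the `p^k`-torsion, and TOWER-COMPATIBLE: `ι M (p^{M−k} m) = ι k m` for `k ≤ M` (the transition `ℤ/p^k → ℤ/p^M` is multiplication
by `p^{M−k}`). Existence statement (no definition). [cite: Hungerford1974, Ch. I §3 Exercise 7 (a),(d) (PDF p. 88)] -/
theorem exists_levelHoms : ∃ ι : (k : ℕ) → (ZMod (p ^ k) →+ QpModZp p),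
    (∀ (k : ℕ) (m : ℤ), ι k m = (m : ℤ_[p]) • tgen p k) ∧
    (∀ k, Function.Injective (ι k)) ∧
    (∀ (k : ℕ) (a : QpModZp p), p ^ k • a = 0 → ∃ x, ι k x = a) ∧
    (∀ (k M : ℕ), k ≤ M → ∀ m : ℤ, ι M ((((p ^ (M - k) : ℕ) : ℤ) * m : ℤ) : ZMod (p ^ M)) = ι k m) := by
  have hker : ∀ k : ℕ, (zmultiplesHom (QpModZp p) (tgen p k)) (p ^ k : ℕ) = 0 := fun k ↦ by
    rw [zmultiplesHom_apply, natCast_zsmul, pow_nsmul_tgen]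
  have hform : ∀ (k : ℕ) (m : ℤ),
      ZMod.lift (p ^ k) ⟨zmultiplesHom (QpModZp p) (tgen p k), hker k⟩ (m : ZMod (p ^ k)) = (m : ℤ_[p]) • tgen p k := by
    intro k m
    rw [ZMod.lift_coe]
    change m • tgen p k = _
    exact zsmul_eq_intCast_smul m _
  refine ⟨fun k ↦ ZMod.lift (p ^ k) ⟨zmultiplesHom (QpModZp p) (tgen p k), hker k⟩, hform, fun k ↦ ?_, fun k a ha ↦ ?_,
    fun k M hkM m ↦ ?_⟩
  · rw [injective_iff_map_eq_zero]
    intro x hx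
    obtain ⟨m, rfl⟩ := ZMod.intCast_surjective x
    rw [hform, intCast_smul_tgen_eq_zero_iff] at hx
    haveI : NeZero (p ^ k) := ⟨pow_ne_zero _ hp.out.ne_zero⟩
    exact (ZMod.intCast_zmod_eq_zero_iff_dvd m (p ^ k)).mpr hx
  · obtain ⟨m, rfl⟩ := exists_eq_natCast_smul_tgen_of_nsmul_eq_zero ha
    exact ⟨((m : ℤ) : ZMod (p ^ k)), by rw [hform, Int.cast_natCast]⟩
  · obtain ⟨d, rfl⟩ := Nat.exists_eq_add_of_le hkM
    rw [Nat.add_sub_cancel_left, hform, hform, Int.cast_mul, Int.cast_natCast, Nat.cast_pow, mul_comm, mul_smul,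
      pow_smul_tgen_add]

/-- **TRANSPORT along `A ≃+ ℚ_p/ℤ_p`.** The five level properties for any additive avatar `A` of `ℚ_p/ℤ_p`: formula through `e`,
injectivity, image `= A[p^k]`, tower compatibility, and `p^k`-divisibility of `A`. [cite: Hungerford1974, Ch. I §3 Exercise 7 (PDF p. 88)] -/
theorem exists_levelHoms_of_addEquiv {A : Type*} [AddCommGroup A] (e : A ≃+ QpModZp p) :
    ∃ ι : (k : ℕ) → (ZMod (p ^ k) →+ A),
      (∀ (k : ℕ) (m : ℤ), e (ι k m) = (m : ℤ_[p]) • tgen p k) ∧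
      (∀ k, Function.Injective (ι k)) ∧
      (∀ (k : ℕ) (a : A), p ^ k • a = 0 → ∃ x, ι k x = a) ∧
      (∀ (k M : ℕ), k ≤ M → ∀ m : ℤ, ι M ((((p ^ (M - k) : ℕ) : ℤ) * m : ℤ) : ZMod (p ^ M)) = ι k m) ∧
      (∀ (k : ℕ) (a : A), ∃ b : A, p ^ k • b = a) := by
  obtain ⟨ι, hform, hinj, hrange, hcompat⟩ := exists_levelHoms (p := p)
  refine ⟨fun k ↦ e.symm.toAddMonoidHom.comp (ι k), fun k m ↦ ?_, fun k ↦ e.symm.injective.comp (hinj k), fun k a ha ↦ ?_,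
    fun k M hkM m ↦ ?_, fun k a ↦ ?_⟩
  · simp only [AddMonoidHom.coe_comp, AddEquiv.coe_toAddMonoidHom, Function.comp_apply, AddEquiv.apply_symm_apply, hform]
  · obtain ⟨x, hx⟩ := hrange k (e a) (by rw [← map_nsmul, ha, map_zero])
    exact ⟨x, by simp only [AddMonoidHom.coe_comp, AddEquiv.coe_toAddMonoidHom, Function.comp_apply, hx,
      AddEquiv.symm_apply_apply]⟩
  · simp only [AddMonoidHom.coe_comp, AddEquiv.coe_toAddMonoidHom, Function.comp_apply, hcompat k M hkM m]
  · obtain ⟨b, hb⟩ := exists_nsmul_eq k (e a)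
    exact ⟨e.symm b, by rw [← map_nsmul, hb, AddEquiv.symm_apply_apply]⟩

/-- **THE LEVELS OF `A_θ = (F/𝓞)(θ)`** (`charModule ∅ θ ≃+ ℚ_p/ℤ_p`, `charModuleEquiv θ`): the five level properties.
[cite: KellerYin2024, §1.1 (arXiv:2402.12781v2 TeX L441–449)] [cite: Hungerford1974, Ch. I §3 Exercise 7 (PDF p. 88)] -/
theorem exists_levelHoms_charModule {K : Type} [Field K]
    (θ : FramedGaloisRep K (padicCoeffIntegers (∅ : Set (PadicAlgCl p))) 1) :
    ∃ ι : (k : ℕ) → (ZMod (p ^ k) →+ charModule (∅ : Set (PadicAlgCl p)) θ),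
      (∀ (k : ℕ) (m : ℤ), charModuleEquiv θ (ι k m) = (m : ℤ_[p]) • tgen p k) ∧
      (∀ k, Function.Injective (ι k)) ∧
      (∀ (k : ℕ) (a : charModule (∅ : Set (PadicAlgCl p)) θ), p ^ k • a = 0 → ∃ x, ι k x = a) ∧
      (∀ (k M : ℕ), k ≤ M → ∀ m : ℤ, ι M ((((p ^ (M - k) : ℕ) : ℤ) * m : ℤ) : ZMod (p ^ M)) = ι k m) ∧
      (∀ (k : ℕ) (a : charModule (∅ : Set (PadicAlgCl p)) θ), ∃ b : charModule (∅ : Set (PadicAlgCl p)) θ, p ^ k • b = a) :=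
  exists_levelHoms_of_addEquiv (charModuleEquiv θ)

/-- **`θ = 1`: `Γ_K` ACTS TRIVIALLY ON `A_θ`** (`unitChar θ = 1`; `charModuleEquiv_galois_smul`).
[cite: KellerYin2024, §1.1 (arXiv:2402.12781v2 TeX L441–449)] -/
theorem smul_eq_self_of_unitChar_eq_one {K : Type} [Field K]
    (θ : FramedGaloisRep K (padicCoeffIntegers (∅ : Set (PadicAlgCl p))) 1) (hθ : ∀ σ : absoluteGaloisGroup K, unitChar θ σ = 1)
    (σ : absoluteGaloisGroup K) (a : charModule (∅ : Set (PadicAlgCl p)) θ) : σ • a = a := by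
  apply (charModuleEquiv θ).injective
  rw [charModuleEquiv_galois_smul, hθ, Units.val_one, one_smul]

/-- `θ = 1`: every stabiliser is open (indeed all of `Γ_K`). [cite: KellerYin2024, §1.1] -/
theorem isOpen_setOf_smul_eq_of_unitChar_eq_one {K : Type} [Field K]
    (θ : FramedGaloisRep K (padicCoeffIntegers (∅ : Set (PadicAlgCl p))) 1) (hθ : ∀ σ : absoluteGaloisGroup K, unitChar θ σ = 1)
    (a : charModule (∅ : Set (PadicAlgCl p)) θ) : IsOpen {σ : absoluteGaloisGroup K | σ • a = a} := by
  simp only [smul_eq_self_of_unitChar_eq_one θ hθ, Set.setOf_true, isOpen_univ]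

end Summit.BirchSwinnertonDyer.BirchSwinnertonDyer.Theorems.PrintCf2.PruferLevels

end
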